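import Summits.QuantumFields.YangMills.Theorems.BalabanLadderIRDisintegrationTVDefs
import Mathlib.MeasureTheory.Measure.SeparableMeasure
import Mathlib.MeasureTheory.Integral.Layercake
import HarnessLib

/-!
# Disintegration of total variation — the inequality `E_π[TV(κ, κ')] ≤ TV(π ⊗ κ, π' ⊗ κ') + TV(π, π')`

Count-neutral helper for crux `stmt-QuantumFields-19354` (`BalabanLadder.IR`): the PROOF of WB0 `DisintegrationTV` of
the card `walls-inherit-bulk` (cert-ideate seat ym-19354-certideate-2 gen 5, `cards/Sketch-g5.lean` 858e45e89aea64b7 §B;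
owner READING R37 (d) «TRUE, size S — MAY LAND as helper … pure `Measure.compProd`»), on a COUNTABLY GENERATED
target space `Y` — the honest hypothesis: the selection of a near-optimal test event `A_x` measurably in `x` uses a
countable measure-dense algebra of test sets (REMARK in the Defs module: without a countability hypothesis on `Y`
the inequality fails).  Main theorem: `disintegrationTV_of_countablyGenerated`.

Contents: §1 elementary facts about the one-sided sup-form `tv` for finite ∕ probability measures (test
inequalities in `ℝ` and `ℝ≥0∞` form, nonnegativity, the reversed test inequality for probability measures, and the
layer-cake bound `∫ b dπ' ≤ ∫ b dπ + tv π π'` for measurable `b ≤ 1`); §2 one countable sequence of test sets that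
is measure-dense for every finite measure on a countably generated space (Mathlib's `Measure.MeasureDense` of the
generated set algebra); §3 the inequality.

ROUTE-INDEPENDENT: Mathlib only (plus the Defs module).  HONEST FRAMING: measure-theoretic bookkeeping for an OPEN
crux of a conditional chain; nothing here bears on `IR` itself.
-/

noncomputable section

open MeasureTheory ProbabilityTheory Set
open scoped ENNReal NNReal symmDiff

namespace Summit.QuantumFields.YangMills.Cruxes.IR.CertIdeate2g5

/-! ## §1 Elementary facts about `tv` for finite measures -/

section TV

variable {X : Type*} [MeasurableSpace X]

/-- The defining set of `tv μ ν` is nonempty (test the empty set). -/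
theorem tv_set_nonempty (μ ν : Measure X) :
    ({r : ℝ | ∃ s : Set X, MeasurableSet s ∧ r = (μ s).toReal - (ν s).toReal}).Nonempty :=
  ⟨0, ∅, MeasurableSet.empty, by simp⟩

/-- The defining set of `tv μ ν` is bounded above by the total mass of `μ` (finite `μ`). -/
theorem tv_set_bddAbove (μ ν : Measure X) [IsFiniteMeasure μ] :
    BddAbove {r : ℝ | ∃ s : Set X, MeasurableSet s ∧ r = (μ s).toReal - (ν s).toReal} := by
  refine ⟨(μ Set.univ).toReal, ?_⟩
  rintro r ⟨s, -, rfl⟩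
  have h1 : (μ s).toReal ≤ (μ Set.univ).toReal :=
    ENNReal.toReal_mono (measure_ne_top μ _) (measure_mono (Set.subset_univ s))
  have h2 : 0 ≤ (ν s).toReal := ENNReal.toReal_nonneg
  linarith

/-- Every measurable set is a test set: `μ s − ν s ≤ tv μ ν`. -/
theorem toReal_sub_le_tv (μ ν : Measure X) [IsFiniteMeasure μ] {s : Set X} (hs : MeasurableSet s) :
    (μ s).toReal - (ν s).toReal ≤ tv μ ν :=
  le_csSup (tv_set_bddAbove μ ν) ⟨s, hs, rfl⟩

/-- `tv` is nonnegative (test the empty set). -/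
theorem tv_nonneg (μ ν : Measure X) [IsFiniteMeasure μ] : 0 ≤ tv μ ν := by
  simpa using toReal_sub_le_tv μ ν MeasurableSet.empty

/-- `tv` is bounded by any common bound of its test values. -/
theorem tv_le_of_forall_le (μ ν : Measure X) {c : ℝ}
    (h : ∀ s : Set X, MeasurableSet s → (μ s).toReal - (ν s).toReal ≤ c) : tv μ ν ≤ c := by
  refine csSup_le (tv_set_nonempty μ ν) ?_
  rintro r ⟨s, hs, rfl⟩
  exact h s hs

/-- `ℝ≥0∞` form of the test inequality: `μ s ≤ ν s + tv μ ν`. -/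
theorem measure_le_add_ofReal_tv (μ ν : Measure X) [IsFiniteMeasure μ] [IsFiniteMeasure ν] {s : Set X}
    (hs : MeasurableSet s) : μ s ≤ ν s + ENNReal.ofReal (tv μ ν) := by
  have h := toReal_sub_le_tv μ ν hs
  rw [← ENNReal.ofReal_toReal (measure_ne_top μ s), ← ENNReal.ofReal_toReal (measure_ne_top ν s),
    ← ENNReal.ofReal_add ENNReal.toReal_nonneg (tv_nonneg μ ν)]
  exact ENNReal.ofReal_le_ofReal (by linarith)

/-- For PROBABILITY measures the one-sided `tv` also controls the reversed differences (test the complement). -/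
theorem toReal_sub_le_tv_symm (μ ν : Measure X) [IsProbabilityMeasure μ] [IsProbabilityMeasure ν] {s : Set X}
    (hs : MeasurableSet s) : (ν s).toReal - (μ s).toReal ≤ tv μ ν := by
  have h := toReal_sub_le_tv μ ν hs.compl
  rw [prob_compl_eq_one_sub hs, prob_compl_eq_one_sub hs, ENNReal.toReal_sub_of_le prob_le_one ENNReal.one_ne_top,
    ENNReal.toReal_sub_of_le prob_le_one ENNReal.one_ne_top, ENNReal.toReal_one] at h
  linarith

/-- `ℝ≥0∞` form of the reversed test inequality for probability measures: `ν s ≤ μ s + tv μ ν`. -/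
theorem measure_le_add_ofReal_tv_symm (μ ν : Measure X) [IsProbabilityMeasure μ] [IsProbabilityMeasure ν]
    {s : Set X} (hs : MeasurableSet s) : ν s ≤ μ s + ENNReal.ofReal (tv μ ν) := by
  have h := toReal_sub_le_tv_symm μ ν hs
  rw [← ENNReal.ofReal_toReal (measure_ne_top μ s), ← ENNReal.ofReal_toReal (measure_ne_top ν s),
    ← ENNReal.ofReal_add ENNReal.toReal_nonneg (tv_nonneg μ ν)]
  exact ENNReal.ofReal_le_ofReal (by linarith)

/-- If `μ s ≤ ν s + u` for every measurable `s` (`u` finite), then `tv μ ν ≤ u`. -/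
theorem ofReal_tv_le (μ ν : Measure X) [IsFiniteMeasure μ] [IsFiniteMeasure ν] {u : ℝ≥0∞} (hu : u ≠ ∞)
    (h : ∀ s : Set X, MeasurableSet s → μ s ≤ ν s + u) : ENNReal.ofReal (tv μ ν) ≤ u := by
  rw [← ENNReal.ofReal_toReal hu]
  refine ENNReal.ofReal_le_ofReal (tv_le_of_forall_le μ ν fun s hs => ?_)
  have h1 := ENNReal.toReal_mono (ENNReal.add_ne_top.2 ⟨measure_ne_top ν s, hu⟩) (h s hs)
  rw [ENNReal.toReal_add (measure_ne_top ν s) hu] at h1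
  linarith

/-- **Layer cake against `tv`.**  For probability measures `π, π'` and a measurable `b : X → ℝ≥0∞` with `b ≤ 1`:
`∫ b dπ' ≤ ∫ b dπ + tv π π'`. -/
theorem lintegral_le_lintegral_add_tv (π π' : Measure X) [IsProbabilityMeasure π] [IsProbabilityMeasure π']
    {b : X → ℝ≥0∞} (hb : Measurable b) (hb1 : ∀ x, b x ≤ 1) :
    ∫⁻ x, b x ∂π' ≤ ∫⁻ x, b x ∂π + ENNReal.ofReal (tv π π') := by
  set c : ℝ≥0∞ := ENNReal.ofReal (tv π π') with hc
  -- pass to the real-valued `f = b.toReal` and the layer-cake formula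
  set f : X → ℝ := fun x => (b x).toReal with hf
  have hfm : Measurable f := hb.ennreal_toReal
  have hf0 : ∀ x, 0 ≤ f x := fun x => ENNReal.toReal_nonneg
  have hf1 : ∀ x, f x ≤ 1 := fun x => by
    have := ENNReal.toReal_mono ENNReal.one_ne_top (hb1 x)
    simpa [hf] using this
  have hbf : ∀ x, b x = ENNReal.ofReal (f x) := fun x =>
    (ENNReal.ofReal_toReal (ne_top_of_le_ne_top ENNReal.one_ne_top (hb1 x))).symm
  have hlc : ∀ (μ : Measure X), ∫⁻ x, b x ∂μ = ∫⁻ t in Ioi 0, μ {x : X | t < f x} := fun μ => by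
    simp_rw [hbf]
    exact lintegral_eq_lintegral_meas_lt μ (Filter.Eventually.of_forall hf0) hfm.aemeasurable
  rw [hlc π', hlc π]
  -- pointwise: `π' {t < f} ≤ π {t < f} + c · 𝟙_{t < 1}`
  set g : ℝ → ℝ≥0∞ := (Iio (1 : ℝ)).indicator fun _ => c with hg
  have hgm : Measurable g := measurable_const.indicator measurableSet_Iio
  have hpt : ∀ t : ℝ, π' {x : X | t < f x} ≤ π {x : X | t < f x} + g t := fun t => by
    by_cases ht : t < 1
    · have hE : MeasurableSet {x : X | t < f x} := measurableSet_lt measurable_const hfm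
      simpa [hg, ht] using measure_le_add_ofReal_tv_symm π π' hE
    · have hE : {x : X | t < f x} = ∅ := by
        ext x
        simp only [mem_setOf_eq, mem_empty_iff_false, iff_false, not_lt]
        exact (hf1 x).trans (not_lt.1 ht)
      simp [hE]
  calc ∫⁻ t in Ioi 0, π' {x : X | t < f x}
      ≤ ∫⁻ t in Ioi 0, (π {x : X | t < f x} + g t) := lintegral_mono fun t => hpt t
    _ = (∫⁻ t in Ioi 0, π {x : X | t < f x}) + ∫⁻ t in Ioi 0, g t := lintegral_add_right _ hgm
    _ = (∫⁻ t in Ioi 0, π {x : X | t < f x}) + c := by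
        congr 1
        rw [hg, lintegral_indicator_const measurableSet_Iio, Measure.restrict_apply measurableSet_Iio,
          Iio_inter_Ioi, Real.volume_Ioo]
        simp

end TV

/-! ## §2 A countable measure-dense sequence of test sets on a countably generated space -/

section Dense

variable {Y : Type*} [MeasurableSpace Y]

/-- On a countably generated measurable space there is ONE sequence of measurable sets, containing `∅`, that is
measure-dense for EVERY finite measure (the set algebra generated by a countable generating family). -/
theorem exists_measureDense_seq [MeasurableSpace.CountablyGenerated Y] :
    ∃ A : ℕ → Set Y, (∀ k, MeasurableSet (A k)) ∧ (∃ k, A k = ∅) ∧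
      ∀ (μ : Measure Y) [IsFiniteMeasure μ] (s : Set Y), MeasurableSet s →
        ∀ ε : ℝ, 0 < ε → ∃ k, μ (s ∆ A k) < ENNReal.ofReal ε := by
  set 𝒜 : Set (Set Y) := generateSetAlgebra (MeasurableSpace.countableGeneratingSet Y) with h𝒜def
  have h𝒜alg : IsSetAlgebra 𝒜 := isSetAlgebra_generateSetAlgebra
  have h𝒜c : 𝒜.Countable := countable_generateSetAlgebra MeasurableSpace.countable_countableGeneratingSet
  have hgen : ‹MeasurableSpace Y› = MeasurableSpace.generateFrom 𝒜 := by
    rw [h𝒜def, generateFrom_generateSetAlgebra_eq, MeasurableSpace.generateFrom_countableGeneratingSet]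
  have hmeas : ∀ s ∈ 𝒜, MeasurableSet s := by
    have hℬ : IsSetAlgebra {s : Set Y | MeasurableSet s} :=
      ⟨MeasurableSet.empty, fun s hs => hs.compl, fun s t hs ht => hs.union ht⟩
    exact IsSetAlgebra.generateSetAlgebra_subset
      (fun s hs => MeasurableSpace.measurableSet_countableGeneratingSet hs) hℬ
  have hne : 𝒜.Nonempty := ⟨∅, h𝒜alg.empty_mem⟩
  obtain ⟨A, hA⟩ := h𝒜c.exists_eq_range hne
  have hmem : ∀ k, A k ∈ 𝒜 := fun k => hA ▸ Set.mem_range_self k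
  refine ⟨A, fun k => hmeas _ (hmem k), ?_, fun μ _ s hs ε hε => ?_⟩
  · have h0 : (∅ : Set Y) ∈ Set.range A := hA ▸ h𝒜alg.empty_mem
    obtain ⟨k, hk⟩ := h0
    exact ⟨k, hk⟩
  · have hd : μ.MeasureDense 𝒜 := Measure.MeasureDense.of_generateFrom_isSetAlgebra_finite μ h𝒜alg hgen
    obtain ⟨t, ht, hμ⟩ := hd.approx s hs (measure_ne_top μ s) ε hε
    obtain ⟨k, rfl⟩ : t ∈ Set.range A := hA ▸ ht
    exact ⟨k, hμ⟩

end Dense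

/-! ## §3 The disintegration-of-TV inequality -/

section Main

variable {X Y : Type*} [MeasurableSpace X] [MeasurableSpace Y]

/-- **Disintegration of total variation (WB0 of the card `walls-inherit-bulk`; owner READING R37 (d)).**
On a countably generated target space `Y`: for probability laws `π, π'` on `X` and Markov kernels `κ, κ' : X → Y`,
`∫⁻ TV(κ_x, κ'_x) dπ ≤ TV(π ⊗ κ, π' ⊗ κ') + TV(π, π')`.

Proof.  Fix a countable measure-dense sequence `A k` of test sets on `Y` (§2).  (1) For every `x`,
`TV(κ_x, κ'_x) ≤ T x := ⨆_k (κ_x (A k) − κ'_x (A k))` by density of the `A k` in `(κ_x + κ'_x)`-measure.  (2) For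
`ε > 0` select measurably the first `k(x)` with `T x < (κ_x − κ'_x)(A k) + ε` and `κ'_x (A k) ≤ κ_x (A k)`
(`measurable_find`), and test the joint laws on `S = {(x, y) | y ∈ A (k x)}`:
`∫ T dπ + ∫ κ'_x(A_{k x}) dπ ≤ (π ⊗ κ) S + ε ≤ (π' ⊗ κ') S + TV(joint) + ε = ∫ κ'_x(A_{k x}) dπ' + … ≤
∫ κ'_x(A_{k x}) dπ + TV(π, π') + TV(joint) + ε` (the last step is the layer-cake bound for `[0,1]`-valued
integrands); cancel the finite common term and let `ε → 0`. -/
theorem disintegrationTV_of_countablyGenerated [MeasurableSpace.CountablyGenerated Y] : DisintegrationTV X Y := by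
  intro π π' _ _ κ κ' _ _
  obtain ⟨A, hA, ⟨k₀, hk₀⟩, hdense⟩ := exists_measureDense_seq (Y := Y)
  -- the countable sup `T`
  set D : ℕ → X → ℝ≥0∞ := fun k x => κ x (A k) - κ' x (A k) with hD
  have hDm : ∀ k, Measurable (D k) := fun k => (κ.measurable_coe (hA k)).sub (κ'.measurable_coe (hA k))
  set T : X → ℝ≥0∞ := fun x => ⨆ k, D k x with hT
  have hTm : Measurable T := Measurable.iSup hDm
  have hD1 : ∀ k x, D k x ≤ 1 := fun k x => tsub_le_self.trans prob_le_one
  have hT1 : ∀ x, T x ≤ 1 := fun x => iSup_le fun k => hD1 k x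
  have hTfin : ∀ x, T x ≠ ∞ := fun x => ne_top_of_le_ne_top ENNReal.one_ne_top (hT1 x)
  -- Step 1: pointwise `ofReal (tv (κ x) (κ' x)) ≤ T x`
  have hptw : ∀ x, ENNReal.ofReal (tv (κ x) (κ' x)) ≤ T x := by
    intro x
    refine ofReal_tv_le _ _ (hTfin x) fun s hs => ?_
    refine ENNReal.le_of_forall_pos_le_add fun δ hδ _ => ?_
    have hδ' : (0 : ℝ) < (δ : ℝ) := by exact_mod_cast hδ
    obtain ⟨k, hk⟩ := hdense (κ x + κ' x) s hs δ hδ'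
    rw [Measure.add_apply, ENNReal.ofReal_coe_nnreal] at hk
    have h1 : κ x s ≤ κ x (A k) + κ x (s ∆ A k) := tsub_le_iff_left.1 le_measure_symmDiff
    have h2 : κ x (A k) ≤ D k x + κ' x (A k) := le_tsub_add
    have h3 : κ' x (A k) ≤ κ' x s + κ' x (s ∆ A k) := by
      rw [symmDiff_comm]
      exact tsub_le_iff_left.1 le_measure_symmDiff
    have h4 : D k x ≤ T x := le_iSup (fun k => D k x) k
    calc κ x s ≤ κ x (A k) + κ x (s ∆ A k) := h1
      _ ≤ (D k x + κ' x (A k)) + κ x (s ∆ A k) := by gcongr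
      _ ≤ (T x + (κ' x s + κ' x (s ∆ A k))) + κ x (s ∆ A k) := by gcongr
      _ = κ' x s + T x + (κ x (s ∆ A k) + κ' x (s ∆ A k)) := by ring
      _ ≤ κ' x s + T x + δ := add_le_add le_rfl hk.le
  -- Step 2: the main estimate for the measurable majorant `T`
  have hmain : ∫⁻ x, T x ∂π ≤
      ENNReal.ofReal (tv (π.compProd κ) (π'.compProd κ')) + ENNReal.ofReal (tv π π') := by
    refine ENNReal.le_of_forall_pos_le_add fun ε hε _ => ?_
    have hε' : (0 : ℝ≥0∞) < ε := by exact_mod_cast hε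
    have hεtop : ((ε : ℝ≥0∞)) ≠ ∞ := ENNReal.coe_ne_top
    classical
    -- the selection predicate and its witness
    let P : ℕ → X → Prop := fun k x => T x < D k x + ε ∧ κ' x (A k) ≤ κ x (A k)
    have hPm : ∀ k, MeasurableSet {x | P k x} := fun k =>
      (measurableSet_lt hTm ((hDm k).add_const _)).inter
        (measurableSet_le (κ'.measurable_coe (hA k)) (κ.measurable_coe (hA k)))
    have hPex : ∀ x, ∃ k, P k x := by
      intro x
      by_cases hx : T x < ε
      · refine ⟨k₀, ?_, ?_⟩
        · exact hx.trans_le le_add_self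
        · simp [hk₀]
      · push Not at hx
        have hT0 : T x ≠ 0 := (hε'.trans_le hx).ne'
        have hlt : T x - ε < T x := ENNReal.sub_lt_self (hTfin x) hT0 hε'.ne'
        obtain ⟨k, hk⟩ := lt_iSup_iff.1 hlt
        refine ⟨k, (ENNReal.sub_lt_iff_lt_right hεtop hx).1 hk, ?_⟩
        have : 0 < D k x := pos_of_gt hk
        exact (tsub_pos_iff_lt.1 this).le
    let ksel : X → ℕ := fun x => Nat.find (hPex x)
    have hksel : ∀ x, P (ksel x) x := fun x => Nat.find_spec (hPex x)
    have hkm : Measurable ksel := measurable_find (p := fun x k => P k x) hPex hPm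
    -- the selected test values
    let a : X → ℝ≥0∞ := fun x => κ x (A (ksel x))
    let b : X → ℝ≥0∞ := fun x => κ' x (A (ksel x))
    have ham : Measurable a :=
      Measurable.find (f := fun n x => κ x (A n)) (p := P) (fun n => κ.measurable_coe (hA n)) hPm hPex
    have hbm : Measurable b :=
      Measurable.find (f := fun n x => κ' x (A n)) (p := P) (fun n => κ'.measurable_coe (hA n)) hPm hPex
    have hb1 : ∀ x, b x ≤ 1 := fun x => prob_le_one
    have hpt : ∀ x, T x + b x ≤ a x + ε := by
      intro x
      obtain ⟨h1, h2⟩ := hksel x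
      have h3 : D (ksel x) x + b x = a x := tsub_add_cancel_of_le h2
      calc T x + b x ≤ (D (ksel x) x + ε) + b x := add_le_add h1.le le_rfl
        _ = a x + ε := by rw [add_right_comm, h3]
    -- the joint test set
    let S : Set (X × Y) := ⋃ n, (ksel ⁻¹' {n}) ×ˢ A n
    have hS : MeasurableSet S :=
      MeasurableSet.iUnion fun n => (hkm (measurableSet_singleton n)).prod (hA n)
    have hSx : ∀ x, Prod.mk x ⁻¹' S = A (ksel x) := by
      intro x
      ext y
      simp only [S, Set.mem_preimage, Set.mem_iUnion, Set.mem_prod, Set.mem_singleton_iff]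
      constructor
      · rintro ⟨n, hn, hy⟩
        exact hn ▸ hy
      · intro hy
        exact ⟨ksel x, rfl, hy⟩
    have hj1 : (π.compProd κ) S = ∫⁻ x, a x ∂π := by
      rw [Measure.compProd_apply hS]
      simp_rw [hSx]
      rfl
    have hj2 : (π'.compProd κ') S = ∫⁻ x, b x ∂π' := by
      rw [Measure.compProd_apply hS]
      simp_rw [hSx]
      rfl
    -- integrate the pointwise inequality
    have hint : ∫⁻ x, T x ∂π + ∫⁻ x, b x ∂π ≤ ∫⁻ x, a x ∂π + ε := by
      calc ∫⁻ x, T x ∂π + ∫⁻ x, b x ∂π = ∫⁻ x, (T x + b x) ∂π := (lintegral_add_left hTm _).symm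
        _ ≤ ∫⁻ x, (a x + ε) ∂π := lintegral_mono hpt
        _ = ∫⁻ x, a x ∂π + ε := by
            rw [lintegral_add_right _ measurable_const, lintegral_const, measure_univ, mul_one]
    have hj : ∫⁻ x, a x ∂π ≤ ∫⁻ x, b x ∂π' + ENNReal.ofReal (tv (π.compProd κ) (π'.compProd κ')) := by
      rw [← hj1, ← hj2]
      exact measure_le_add_ofReal_tv _ _ hS
    have hm : ∫⁻ x, b x ∂π' ≤ ∫⁻ x, b x ∂π + ENNReal.ofReal (tv π π') :=
      lintegral_le_lintegral_add_tv π π' hbm hb1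
    have hbfin : ∫⁻ x, b x ∂π ≠ ∞ := by
      refine ne_top_of_le_ne_top ENNReal.one_ne_top ?_
      calc ∫⁻ x, b x ∂π ≤ ∫⁻ _, 1 ∂π := lintegral_mono hb1
        _ = 1 := by simp
    have hsum : ∫⁻ x, T x ∂π + ∫⁻ x, b x ∂π ≤
        (ENNReal.ofReal (tv (π.compProd κ) (π'.compProd κ')) + ENNReal.ofReal (tv π π') + ε) +
          ∫⁻ x, b x ∂π := by
      calc ∫⁻ x, T x ∂π + ∫⁻ x, b x ∂π ≤ ∫⁻ x, a x ∂π + ε := hint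
        _ ≤ (∫⁻ x, b x ∂π' + ENNReal.ofReal (tv (π.compProd κ) (π'.compProd κ'))) + ε :=
            add_le_add hj le_rfl
        _ ≤ ((∫⁻ x, b x ∂π + ENNReal.ofReal (tv π π')) +
              ENNReal.ofReal (tv (π.compProd κ) (π'.compProd κ'))) + ε := by gcongr
        _ = _ := by ring
    exact (ENNReal.add_le_add_iff_right hbfin).1 hsum
  -- conclusion
  calc ∫⁻ x, ENNReal.ofReal (tv (κ x) (κ' x)) ∂π ≤ ∫⁻ x, T x ∂π := lintegral_mono hptw
    _ ≤ ENNReal.ofReal (tv (π.compProd κ) (π'.compProd κ')) + ENNReal.ofReal (tv π π') := hmain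
    _ = ENNReal.ofReal (tv (π.compProd κ) (π'.compProd κ') + tv π π') :=
        (ENNReal.ofReal_add (tv_nonneg _ _) (tv_nonneg _ _)).symm

end Main

end Summit.QuantumFields.YangMills.Cruxes.IR.CertIdeate2g5

end
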